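import Mathlib

/-!
# Crux `EnsembleRealization` (stmt-AnomalousDissipation-0215) — line `augmented-lift`,
# sub-stub M1 `stub_augCurrent`, piece (M1a)/L3: smoothing a weighted law by a `C¹` kernel

Supports stmt-AnomalousDissipation-0215 (stub `stub_augCurrent` of line `augmented-lift`, piece
M1a `stub_augCurrentLevelPairs`, step (A3)(i) of `augCurrent-notes.md` §3). Nothing here closes
an item. Theorems only.

The entries of the augmented current are parametric integrals
`z ↦ ∫ κ(z − Z u) F(u) dμ(u)` over a finite measure `μ` (the Foias–Prodi law), with a measurable
coordinate map `Z` into the finite-dimensional coordinate space, an a.e. bounded weight `F`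
(a tested generator `⟨F(u), gⱼ⟩` or the dissipation on the ball) and a `C¹` kernel `κ` which is
bounded with bounded derivative (a mollifier or its energy primitive). Such an integral is `C¹`
in `z`, with derivative the integral of the differentiated kernel (differentiation under the
integral sign, `hasFDerivAt_integral_of_dominated_of_fderiv_le`, and dominated continuity).
Packaged as `stub_augCurrentKernelTools`.
-/

noncomputable section

set_option linter.dupNamespace false

open MeasureTheory Set Filter Topology Function Metric
open scoped BigOperators

namespace Summit.AnomalousDissipation.AnomalousDissipation.Theorems.EnsembleRealization

/-- **Kernel tools for (M1a).** Let `μ` be a finite measure on `Ω`, `Z : Ω → E` measurable into a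
finite-dimensional space, `F : Ω → ℝ` a.e. strongly measurable with `|F| ≤ M` a.e., and
`κ : E → ℝ` of class `C¹` with `|κ| ≤ K`, `‖Dκ‖ ≤ K`. Then `z ↦ ∫ κ(z − Z u) F(u) dμ` has at every
`z` the Fréchet derivative `∫ F(u) • Dκ(z − Z u) dμ`, this derivative is continuous in `z`, and the
function is `C¹`. -/
theorem stub_augCurrentKernelTools {Ω : Type*} [MeasurableSpace Ω] (μ : Measure Ω) [IsFiniteMeasure μ]
    {E : Type*} [NormedAddCommGroup E] [NormedSpace ℝ E] [FiniteDimensional ℝ E]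
    [MeasurableSpace E] [BorelSpace E]
    {Z : Ω → E} (hZ : Measurable Z) {F : Ω → ℝ} (hF : AEStronglyMeasurable F μ) {M : ℝ}
    (hFM : ∀ᵐ u ∂μ, |F u| ≤ M) {κ : E → ℝ} (hκ : ContDiff ℝ 1 κ) {K : ℝ}
    (hκK : ∀ y, |κ y| ≤ K ∧ ‖fderiv ℝ κ y‖ ≤ K) :
    (∀ z, HasFDerivAt (fun z => ∫ u, κ (z - Z u) * F u ∂μ) (∫ u, F u • fderiv ℝ κ (z - Z u) ∂μ) z) ∧
    Continuous (fun z => ∫ u, F u • fderiv ℝ κ (z - Z u) ∂μ) ∧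
    ContDiff ℝ 1 (fun z => ∫ u, κ (z - Z u) * F u ∂μ) := by
  have hκc : Continuous κ := hκ.continuous
  have hκd : Differentiable ℝ κ := hκ.differentiable one_ne_zero
  have hDκc : Continuous (fderiv ℝ κ) := hκ.continuous_fderiv one_ne_zero
  have hZs : AEStronglyMeasurable Z μ := hZ.aestronglyMeasurable
  have hK0 : 0 ≤ K := (abs_nonneg _).trans (hκK 0).1
  -- measurability of the integrands
  have hmeas : ∀ z, AEStronglyMeasurable (fun u => κ (z - Z u) * F u) μ := fun z =>
    ((hκc.comp (continuous_const.sub continuous_id)).comp_aestronglyMeasurable hZs).mul hF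
  have hmeas' : ∀ z, AEStronglyMeasurable (fun u => F u • fderiv ℝ κ (z - Z u)) μ := fun z =>
    hF.smul ((hDκc.comp (continuous_const.sub continuous_id)).comp_aestronglyMeasurable hZs)
  -- integrability (bounded integrands, finite measure)
  have hint : ∀ z, Integrable (fun u => κ (z - Z u) * F u) μ := fun z =>
    Integrable.of_bound (hmeas z) (C := K * M) (hFM.mono fun u hu => by
      rw [Real.norm_eq_abs, abs_mul]
      exact mul_le_mul (hκK _).1 hu (abs_nonneg _) hK0)
  have hbd' : ∀ z, ∀ᵐ u ∂μ, ‖F u • fderiv ℝ κ (z - Z u)‖ ≤ M * K := fun z =>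
    hFM.mono fun u hu => by
      rw [norm_smul, Real.norm_eq_abs]
      exact mul_le_mul hu (hκK _).2 (norm_nonneg _) ((abs_nonneg _).trans hu)
  -- differentiation under the integral sign
  have hder : ∀ z, HasFDerivAt (fun z => ∫ u, κ (z - Z u) * F u ∂μ) (∫ u, F u • fderiv ℝ κ (z - Z u) ∂μ) z := by
    intro z₀
    refine hasFDerivAt_integral_of_dominated_of_fderiv_le (F' := fun z u => F u • fderiv ℝ κ (z - Z u))
      (bound := fun _ => M * K) univ_mem (Eventually.of_forall hmeas) (hint z₀) (hmeas' z₀)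
      (hFM.mono fun u hu => fun x _ => ?_) (integrable_const _) (Eventually.of_forall fun u z _ => ?_)
    · rw [norm_smul, Real.norm_eq_abs]
      exact mul_le_mul hu (hκK _).2 (norm_nonneg _) ((abs_nonneg _).trans hu)
    · have h1 : HasFDerivAt (fun z : E => z - Z u) (ContinuousLinearMap.id ℝ E) z :=
        (hasFDerivAt_id z).sub_const (Z u)
      have h2 := ((hκd (z - Z u)).hasFDerivAt.comp z h1).mul_const (F u)
      simpa using h2
  -- continuity of the derivative (dominated convergence)
  have hcont : Continuous (fun z => ∫ u, F u • fderiv ℝ κ (z - Z u) ∂μ) :=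
    continuous_of_dominated (F := fun z u => F u • fderiv ℝ κ (z - Z u)) (bound := fun _ => M * K)
      hmeas' hbd' (integrable_const _)
      (Eventually.of_forall fun u => by
        have h1 : Continuous fun x : E => fderiv ℝ κ (x - Z u) := hDκc.comp (continuous_id.sub continuous_const)
        exact h1.const_smul (F u))
  refine ⟨hder, hcont, ?_⟩
  rw [contDiff_one_iff_fderiv]
  refine ⟨fun z => (hder z).differentiableAt, ?_⟩
  have hfd : fderiv ℝ (fun z => ∫ u, κ (z - Z u) * F u ∂μ) = fun z => ∫ u, F u • fderiv ℝ κ (z - Z u) ∂μ :=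
    funext fun z => (hder z).fderiv
  rw [hfd]
  exact hcont

end Summit.AnomalousDissipation.AnomalousDissipation.Theorems.EnsembleRealization
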